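import Summits.BirchSwinnertonDyer.Uniform.U2.RankZeroTwistBSDTwoPlacewise
import Summits.BirchSwinnertonDyer.BirchSwinnertonDyer.Theorems.AlignedTransportAtTwoOffStratumPartitionTwistFamilySmallSeeds
import HarnessLib

/-!
# Route `AlignedTransportAtTwo`, crux C2 `MainConjectureOfRankZeroBSDAtTwo` (stmt-22298), line `birth` — THE WHOLE `a_q`-ODD TWIST CLASS
# OF A SEMISTABLE-AWAY-FROM-NOTHING SEED IS PRINT-TRANSPORT: `BSD(W, 2)` for every globally minimal model `W` of `S^{(d)}` from
# Zhai 1.1′ + Mazur–Rubin 2010 Lemma 2.10 + modularity + Abbes–Ullmo + `BSD(S, 2)` — NO Kato, NO tower-gap certificate, NO split condition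

HONEST FRAMING (cell `bsd-f1-sign2`, WIDTH-5 attach seat `bsd-line-att-p4` g24; `--supports stmt-BirchSwinnertonDyer-22298 --as helper`).
THEOREMS ONLY (no `def`, no named fact, no `sorry`). BSD is NOT proved; C1/C2/C3′ are NOT closed; nothing is asserted — every statement is
CONDITIONAL on the displayed PRINT named facts (hypotheses) and the seed's displayed data. This file is a THIN ADAPTER: the mathematics of the
Selmer side is cell `bsd-uniform`'s track U2 (`Uniform/U2/RankZeroTwistBSDTwoPlacewise.lean`,
`U2.bsdp_two_twist_of_rankZero_base_oddConductor_placewise`: Zhai's unit + Mazur–Rubin place-wise local constancy of `#Sel₂` on the `a_q`-odd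
class + the `2`-adic Tamagawa balance of an unramified twist), consumed BY NAME; nothing of it is re-proved here.

WHY. The lineage's (T) twist-family rows (g22 `…TwistFamilyBSD`, g23 `…TwistFamilyZhai{,Split,Explicit}`) left the partition of the
rank-zero twist family of a certified seed `S` as: `T_Z^split` (every `q ∣ M` inert in the cubic field `F`, every bad prime of `S` split in
`ℚ(√M)`) = BSD₂ IN PRINT (Zhai arXiv v2 Thm. 1.2); `T_Z ∖ T_Z^split` = `L`-side print, SELMER SIDE = CELL (PRINT⁸ incl. Kato 17.4 at `2` +
the seed's tower-gap CERTIFICATE). REF2 g58 (21:28:52Z): «MR10 local constancy is the print-in-substance alternative GIVEN `Sel₂(S) = 0`».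
It is, and it is already KERNEL in the tree (U2). This file instantiates it in the lineage's currency:

* §1 **`perBase_of_bsdp_of_isLAlg`** — the per-base binders U2 asks for (`r_an(S) = 0`, `Ш(S)[2] = 0`, `c(S)` odd) are DERIVED from
  `BSD(S, 2)` + `S(ℚ)[2] = 0` + Zhai's unit datum `hL : L(S,1) = x·Ω_∞(S)`, `x ≠ 0`, `ord₂ x = ord₂ c_∞(S)`: Miller's
  `#Ш_an = L·T²/(Ω·c·Reg)` then has `ord₂ #Ш_an = −ord₂ c(S)`, and `ord₂ #Ш_an = ord₂ #Ш(S)[2^∞] ≥ 0` forces `ord₂ c(S) = 0 = ord₂ #Ш(S)[2^∞]`.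
  So the displayed per-seed data stay EXACTLY g23's {optimality datum `Dt`, `hL`}.
* §2 **`bsdp_two_twist_oddTrace_of_print`** — GENERIC: `S` globally minimal of ODD conductor, every bad prime MULTIPLICATIVE with ODD
  `ord_p Δ(S)` (so Mazur–Rubin's splitting conditions `hadd`/`hmev` are VACUOUS), `E[2]` irreducible, `Δ(S) < 0`, `BSD(S, 2)`, data {`Dt`, `hL`};
  then for EVERY square-free `d ≡ 1 (mod 4)`, `d ≠ 1`, `(d, N_S) = 1` with `a_q(S)` odd at every prime `q ∣ d`, and every globally minimal
  model `W` of `S^{(d)}`: `r_an(W) = 0 ∧ rank W(ℚ) = 0 ∧ Ш(W)[2^∞] = 0 ∧ c(W) odd ∧ BSD(W, 2)` — modulo PRINT⁵ {Zhai 2016 Thm. 1.1′/1.2′,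
  Mazur–Rubin 2010 Lemma 2.10 (place-wise), modularity, Abbes–Ullmo Thm. A} + `BSD(S, 2)`. NO Kato, NO Matsuno/Greenberg, NO tower-gap
  certificate, NO «bad primes split in `ℚ(√d)`», nothing about the member. (`q ∤ Δ_min(S)` for `q ∣ d` is derived from `(d, N_S) = 1`.)
* §3 ROW with `BSD(S, 2)` := Creutz–Miller 2012 (PRINT, `N < 5000`; `r_an(S) = 0` now DERIVED from `hL`): **`bsdp_two_twist_oddTrace_1727a1`**
  (`Δ = −11·157`) — displayed data = {`Dt`, `hL`}, class condition on `d` = {square-free, `≡ 1 (mod 4)`, `≠ 1`, `(d, 1727) = 1`, `a_q` odd ∀ prime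
  `q ∣ d`} (LMFDB-checkable). The sibling file `…TwistFamilyZhaiTransportSeeds` carries the rows of `2071a1`, `4087a1`, `4087c1`, `2045b1`.

PARTITION CURRENCY (D-0171; to -imc / REF2), (T) row of these seeds refined: the WHOLE Zhai class `T_Z` (a_q-odd form; it contains g23's
`IsInertIn` form by `U2.isInertIn_of_odd_frobeniusTrace`) has `r_an = 0` PRINT and **BSD₂ = PRINT-TRANSPORT × print base** (PRINT⁵ + Creutz–Miller +
GZK + {`Dt`, `hL`}) with ZERO certificates — `T_Z ∖ T_Z^split` leaves the «Selmer side = cell» column. `MC₂` of the members stays on the cell road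
(g22, PRINT⁷ + cert): that step IS crux C2. Beyond-print theorem: no (U2's transport is Zhai + Mazur–Rubin bookkeeping). BSD is NOT proved.

References: [Zhai2016] Thm. 1.1 / 1.2 (arXiv v2 Thm. 1.1 / 1.3); [MazurRubin2010] Lemma 2.10, Prop. 3.3, Prop. 4.2; [AbbesUllmo1996] Thm. A;
[CreutzMiller2012] Thm. 1.1; [Miller2011LMS] Def. 1.1; [SilvermanAEC2009] VII.5 Prop. 5.1; [CremonaAlgorithms1997] Table 1.
-/

set_option autoImplicit false
set_option linter.dupNamespace false

noncomputable section

open scoped Classical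

open WeierstrassCurve NumberField
open Literature.NumberTheory.EllipticCurves Literature.NumberTheory.EllipticCurves.ModularForms
open Literature.NumberTheory.EllipticCurves.Rank1Residual Literature.NumberTheory.EllipticCurves.Rank1Residual.Typed
open Literature.NumberTheory.EllipticCurves.CoatesLiTianZhai2015 Literature.NumberTheory.EllipticCurves.Zhai2016
open Summit.BirchSwinnertonDyer.Rank1Residual Summit.BirchSwinnertonDyer.Rank1Residual.X5
open Summit.BirchSwinnertonDyer.Uniform
open Summit.BirchSwinnertonDyer.BirchSwinnertonDyer.Theorems.TowerClass
open Summit.BirchSwinnertonDyer.BirchSwinnertonDyer.Theorems.AlignedTransportAtTwoTwistFamilySmallSeeds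
open Summit.BirchSwinnertonDyer.BirchSwinnertonDyer.Theorems

namespace Summit.BirchSwinnertonDyer.BirchSwinnertonDyer.Theorems.AlignedTransportAtTwoTwistFamilyZhaiTransport

/-! ## §1 The per-base Selmer binders from `BSD(S, 2)` + Zhai's unit datum -/

section PerBase

variable (S : WeierstrassCurve ℚ) [S.IsElliptic]

/-- `Ω_∞(S) ≠ 0` (it is `Ω(S)/c_∞(S)` with `Ω(S) > 0`, `c_∞ ∈ {1, 2}`). [folklore] -/
theorem leastRealPeriod_ne_zero : leastRealPeriod S ≠ 0 := by
  unfold leastRealPeriod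
  exact div_ne_zero S.realPeriodRat_pos_holds.ne'
    (by exact_mod_cast (WeierstrassCurve.numRealComponents_pos (S.baseChange ℝ)).ne')

/-- Zhai's unit datum gives `L(S, 1) ≠ 0`, hence `r_an(S) = 0` (granting `L(S, s)` entire). [cite: Zhai2016, §1 (arXiv:1409.0231 chunk p0002 L12–L18)] -/
theorem analyticRank_eq_zero_of_isLAlg (hE : hasEntireLFunction_rat) {x : ℚ} (hx : IsLAlg S x) (hx0 : x ≠ 0) :
    S.analyticRank = 0 :=
  (S.analyticRank_eq_zero_iff_holds (hE S)).2 (entireLFunction_one_ne_zero_of_isLAlg hx hx0 (leastRealPeriod_ne_zero S))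

/-- `E[2]` irreducible ⟹ no rational point `P ≠ 0` with `2P = 0` (U2's binder `hT`). [cite: SilvermanAEC2009, III.2.3 (b)] -/
theorem forall_two_nsmul_eq_zero_of_irr (hirr : Irr S 2) : ∀ P : S.toAffine.Point, 2 • P = 0 → P = 0 := by
  intro P hP
  have hne := (O1.irr_two_iff_not_exists_addOrderOf_eq_two S).mp hirr
  have hdvd : addOrderOf P ∣ 2 := addOrderOf_dvd_of_nsmul_eq_zero hP
  rcases (Nat.dvd_prime Nat.prime_two).mp hdvd with h1 | h2
  · exact AddMonoid.addOrderOf_eq_one_iff.mp h1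
  · exact absurd ⟨P, h2⟩ hne

omit [S.IsElliptic] in
/-- `Ш(S)[2^∞] = 0` (as a subgroup) ⟹ `Ш(S)[2] = 0` elementwise (U2's binder `hSha`). [folklore] -/
theorem forall_sha_two_of_primaryComponent_eq_bot (h : AddCommGroup.primaryComponent S.sha 2 = ⊥) :
    ∀ x : S.galH1, x ∈ S.sha → 2 • x = 0 → x = 0 := by
  intro x hx h2
  have hmem : (⟨x, hx⟩ : S.sha) ∈ AddCommGroup.primaryComponent S.sha 2 := by
    refine (AddCommGroup.mem_primaryComponent).mpr ⟨1, ?_⟩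
    apply Subtype.ext
    simpa using h2
  rw [h, AddSubgroup.mem_bot] at hmem
  exact congrArg Subtype.val hmem

/-- **THE PER-BASE BINDERS FROM `BSD(S, 2)` + ZHAI'S UNIT DATUM.** For a globally minimal elliptic `S/ℚ` with `E[2]` irreducible, Miller's
`BSD(S, 2)` and `L(S, 1) = x · Ω_∞(S)` with `x ≠ 0`, `ord₂ x = ord₂ c_∞(S)` (granting `L(E, s)` entire): `r_an(S) = 0`, `Ш(S)[2^∞] = 0` and
`c(S)` is odd. Indeed `#Ш_an = L·T²/(Ω·c·Reg) = (x/c_∞)·T²/c` (`Reg = 1`, `Ω = c_∞ Ω_∞`) has `ord₂ = −ord₂ c` (`T` odd), while `BSD(S,2)` says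
`ord₂ #Ш_an = ord₂ #Ш(S)[2^∞] ≥ 0`; so both vanish, and a finite `2`-group of order prime to `2` is trivial. (Converse bookkeeping of
`U2.exists_isLAlg_of_bsdp_two`.) [cite: Miller2011LMS, Def. 1.1] [cite: Zhai2016, §1 (arXiv:1409.0231 chunk p0002 L12–L18)] -/
theorem perBase_of_bsdp_of_isLAlg (hE : hasEntireLFunction_rat) (hbsd : BSDp S 2) (hirr : Irr S 2)
    (hL : ∃ x : ℚ, IsLAlg S x ∧ x ≠ 0 ∧ padicValRat 2 x = padicValNat 2 (S.baseChange ℝ).numRealComponents) :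
    S.analyticRank = 0 ∧ AddCommGroup.primaryComponent S.sha 2 = ⊥ ∧ Odd S.tamagawaProduct := by
  haveI : Fact (Nat.Prime 2) := ⟨Nat.prime_two⟩
  obtain ⟨x, hx, hx0, hvx⟩ := hL
  have hr : S.analyticRank = 0 := analyticRank_eq_zero_of_isLAlg S hE hx hx0
  obtain ⟨hrk, hfin, q, hq, hv⟩ := hbsd
  haveI := hfin
  have hrk0 : S.mordellWeilRank = 0 := hrk.trans hr
  have hReg : S.regulator = 1 := S.regulator_eq_one_of_rank_zero hrk0
  have hlead := P2.leadingLCoeff_eq_of_isLAlg S hx hr hrk0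
  -- odd torsion
  have htor : padicValNat 2 S.torsionOrder = 0 := padicValNat_torsionOrder_eq_zero_of_irreducible S 2 hirr
  -- positivity
  have hTpos : (0 : ℕ) < S.torsionOrder := S.torsionOrder_pos_holds
  have hcpos : 0 < S.tamagawaProduct := S.tamagawaProduct_pos'
  have hΩpos : 0 < S.realPeriodRat := S.realPeriodRat_pos_holds
  have hcinf : 0 < (S.baseChange ℝ).numRealComponents := WeierstrassCurve.numRealComponents_pos (S.baseChange ℝ)
  have hTC : (S.torsionOrder : ℂ) ≠ 0 := by exact_mod_cast hTpos.ne'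
  have hcC : (S.tamagawaProduct : ℂ) ≠ 0 := by exact_mod_cast hcpos.ne'
  have hΩC : (S.realPeriodRat : ℂ) ≠ 0 := by exact_mod_cast hΩpos.ne'
  have hTq : (S.torsionOrder : ℚ) ≠ 0 := by exact_mod_cast hTpos.ne'
  have hcq : (S.tamagawaProduct : ℚ) ≠ 0 := by exact_mod_cast hcpos.ne'
  have hciq : (((S.baseChange ℝ).numRealComponents : ℕ) : ℚ) ≠ 0 := by exact_mod_cast hcinf.ne'
  -- `q = (x / c_∞) · T² / c` as rational numbers
  have hqeq : q = x / ((S.baseChange ℝ).numRealComponents : ℚ) * (S.torsionOrder : ℚ) ^ 2 / (S.tamagawaProduct : ℚ) := by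
    have h := hq
    rw [shaAn_def, hlead, hReg] at h
    apply Rat.cast_injective (α := ℂ)
    rw [← h]
    push_cast
    field_simp
  have hx' : x / ((S.baseChange ℝ).numRealComponents : ℚ) ≠ 0 := div_ne_zero hx0 hciq
  -- `ord₂ q = −ord₂ c`
  have hvq : padicValRat 2 q = -(padicValNat 2 S.tamagawaProduct : ℤ) := by
    rw [hqeq, padicValRat.div (mul_ne_zero hx' (pow_ne_zero 2 hTq)) hcq, padicValRat.mul hx' (pow_ne_zero 2 hTq),
      padicValRat.div hx0 hciq, padicValRat.pow, padicValRat.of_nat, padicValRat.of_nat, padicValRat.of_nat, hvx, htor]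
    push_cast
    ring
  rw [hvq] at hv
  -- both valuations vanish
  have hc0 : padicValNat 2 S.tamagawaProduct = 0 := by omega
  have hsha0 : padicValNat 2 (Nat.card (AddCommGroup.primaryComponent S.sha 2)) = 0 := by omega
  -- `#Ш(S)[2^∞] = 2ⁿ` with `n = 0`
  obtain ⟨n, hn⟩ := exists_card_addPrimaryComponent_eq_pow (A := S.sha) 2
  rw [hn, padicValNat.prime_pow] at hsha0
  rw [hsha0, pow_zero] at hn
  refine ⟨hr, AddSubgroup.eq_bot_of_card_eq _ hn, ?_⟩
  -- `c(S)` odd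
  rw [padicValNat.eq_zero_iff] at hc0
  rcases hc0 with h | h | h
  · norm_num at h
  · exact absurd h hcpos.ne'
  · exact Nat.odd_iff.mpr (Nat.two_dvd_ne_zero.mp h)

end PerBase

/-! ## §2 The generic print-transport on the `a_q`-odd class of a seed with multiplicative bad primes of odd discriminant valuation -/

section Generic

/-- **`BSD(W, 2)` ON THE WHOLE `a_q`-ODD TWIST CLASS — PRINT-TRANSPORT, generic form.** Let `S/ℚ` be globally minimal, elliptic, with ODD
conductor `N_S`, every prime `p ∣ N_S` of MULTIPLICATIVE reduction with ODD `ord_p Δ(S)`, `E[2]` irreducible, `Δ(S) < 0`; let `Dt` be an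
`X₀(N_S)`-optimality datum (Zhai's «optimal»; Manin constant odd by Abbes–Ullmo since `N_S` is odd), `BSD(S, 2)` (Miller), and Zhai's unit datum
`hL : L(S,1) = x·Ω_∞(S)`, `x ≠ 0`, `ord₂ x = 0`. Let `d` be square-free, `d ≡ 1 (mod 4)`, `d ≠ 1`, `(d, N_S) = 1`, with `a_q(S)` odd at every
prime `q ∣ d`, and `W` any globally minimal model of `S^{(d)}`. Then `r_an(W) = 0`, `rank W(ℚ) = 0`, `Ш(W)[2^∞] = 0`, `c(W)` is odd and
**`BSD(W, 2)`** — modulo PRINT⁵ {Zhai 2016 Thm. 1.1′ (`h11`; `h12` carried by the U2 interface, idle for `Δ < 0`), Mazur–Rubin 2010 Lemma 2.10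
place-wise (`hMR'`), modularity (`hmod`), Abbes–Ullmo Thm. A (`hAU`)} + `BSD(S, 2)`. NO Kato, NO Matsuno/Greenberg, NO tower-gap certificate,
NO «bad primes split in `ℚ(√d)`» (Mazur–Rubin's `hadd`/`hmev` are vacuous: no additive prime, no even `ord_p Δ`). The work is U2's
`bsdp_two_twist_of_rankZero_base_oddConductor_placewise`; the per-base binders it wants come from §1. CONDITIONAL; BSD is NOT proved.
[cite: Zhai2016, Thm. 1.1 (arXiv:1409.0231v2 Thm. 1.1)] [cite: MazurRubin2010, Lemma 2.10 (i)–(v), Prop. 3.3, Prop. 4.2]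
[cite: AbbesUllmo1996, Thm. A] [cite: Miller2011LMS, Def. 1.1] -/
theorem bsdp_two_twist_oddTrace_of_print
    -- named published facts
    (h11 : thm11_ordTwo_LAlg_twist_eq_zero') (h12 : thm12_ordTwo_LAlg_twist_eq_one')
    (hMR' : MazurRubin2010.d2_eq_of_lemma210_rat) (hmod : exists_isNewformOf)
    (hAU : abbesUllmo_not_dvd_maninConstant_of_not_dvd_level)
    -- the seed
    (S W : WeierstrassCurve ℚ) [S.IsElliptic] [S.IsGloballyMinimal] [NeZero (S.conductorNorm ℤ)] [W.IsElliptic] [W.IsGloballyMinimal]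
    (Dt : ModularParametrizationData S (S.conductorNorm ℤ)) (hopt : Zhai2021.IsOptimalDatum S Dt)
    (hN2 : ¬ 2 ∣ S.conductorNorm ℤ)
    (hbad : ∀ (p : ℕ) [Fact p.Prime], p ∣ S.conductorNorm ℤ → S.HasMultiplicativeReductionAtPrime p ∧ Odd (padicValRat p S.Δ))
    (hirr : Irr S 2) (hΔ : S.Δ < 0) (hbsd : BSDp S 2) (hL : ∃ x : ℚ, IsLAlg S x ∧ x ≠ 0 ∧ padicValRat 2 x = 0)
    -- the class condition on `d` (a_q-odd form)
    {d : ℤ} (hsqf : Squarefree d) (hd1 : d ≠ 1) (hd4 : d % 4 = 1) (hgcd : Int.gcd d (S.conductorNorm ℤ) = 1)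
    (hodd : ∀ q : ℕ, q.Prime → (q : ℤ) ∣ d → Odd (S.frobeniusTrace q))
    -- the member
    {c : VariableChange ℚ} (hc : c • S.quadraticTwist (d : ℚ) = W) :
    W.analyticRank = 0 ∧ W.mordellWeilRank = 0 ∧ AddCommGroup.primaryComponent W.sha 2 = ⊥ ∧ Odd W.tamagawaProduct ∧ BSDp W 2 := by
  haveI : Fact (Nat.Prime 2) := ⟨Nat.prime_two⟩
  have hE : hasEntireLFunction_rat := WeierstrassCurve.hasEntireLFunction_rat_of_exists_isNewformOf hmod
  -- §1: the per-base binders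
  have hcinf : (S.baseChange ℝ).numRealComponents = 1 := P2.numRealComponents_eq_one_of_Δ_neg hΔ
  have hL' : ∃ x : ℚ, IsLAlg S x ∧ x ≠ 0 ∧ padicValRat 2 x = padicValNat 2 (S.baseChange ℝ).numRealComponents := by
    obtain ⟨x, hx, hx0, hv⟩ := hL
    exact ⟨x, hx, hx0, by rw [hcinf, hv]; simp⟩
  obtain ⟨hr, hsha, hcS⟩ := perBase_of_bsdp_of_isLAlg S hE hbsd hirr hL'
  have hT := forall_two_nsmul_eq_zero_of_irr S hirr
  have hSha := forall_sha_two_of_primaryComponent_eq_bot S hsha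
  -- the class condition in U2's form: `q ∣ d ⟹ q ∤ N_S ⟹ good at q ⟹ q ∤ Δ_min`
  have hS : ∀ (q : ℕ), q.Prime → (q : ℤ) ∣ d → ¬ (q : ℤ) ∣ minimalDiscriminantInt S ∧ Odd (S.frobeniusTrace q) := by
    intro q hq hqd
    haveI : Fact q.Prime := ⟨hq⟩
    refine ⟨?_, hodd q hq hqd⟩
    have hqN : ¬ q ∣ S.conductorNorm ℤ := by
      intro hqN
      have h1 : (q : ℤ) ∣ (Int.gcd d (S.conductorNorm ℤ) : ℤ) :=
        Int.dvd_coe_gcd hqd (by exact_mod_cast hqN)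
      rw [hgcd] at h1
      exact hq.one_lt.ne' (by exact_mod_cast Int.eq_one_of_dvd_one (by positivity) h1)
    have hgood : S.HasGoodReductionAtPrime q := by
      by_contra h
      exact hqN ((S.dvd_conductorNorm_iff_not_hasGoodReductionAtPrime q).mpr h)
    exact S.not_dvd_minimalDiscriminantInt_of_hasGoodReductionAtPrime q hgood
  -- Mazur–Rubin's splitting conditions are vacuous
  have hadd : ∀ (p : ℕ) [Fact p.Prime], ¬ S.HasGoodReductionAtPrime p → ¬ S.HasMultiplicativeReductionAtPrime p → p ≠ 2 →
      jacobiSym d p = 1 := by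
    intro p _ hng hnm _
    exact absurd (hbad p ((S.dvd_conductorNorm_iff_not_hasGoodReductionAtPrime p).mpr hng)).1 hnm
  have hmev : ∀ (p : ℕ) [Fact p.Prime], S.HasMultiplicativeReductionAtPrime p → Even (padicValRat p S.Δ) → p ≠ 2 →
      jacobiSym d p = 1 := by
    intro p _ hm hev _
    have hng : ¬ S.HasGoodReductionAtPrime p := not_hasGoodReductionAtPrime_of_hasMultiplicativeReductionAtPrime p hm
    exact absurd hev (Int.not_even_iff_odd.mpr (hbad p ((S.dvd_conductorNorm_iff_not_hasGoodReductionAtPrime p).mpr hng)).2)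
  have hM : ∃ C : VariableChange ℚ, C • W = S.quadraticTwist (d : ℚ) := P2.exists_smul_eq_comm.mpr ⟨c, hc⟩
  exact U2.bsdp_two_twist_of_rankZero_base_oddConductor_placewise h11 h12 hMR' hmod hAU S W Dt hopt hN2 hr hbsd hSha hT hcS hsqf hd1
    hd4 hgcd hS hadd hmev (fun h ↦ absurd h (not_lt.mpr hΔ.le)) hM

end Generic

/-! ## §3 Row `1727a1`, `BSD(S, 2)` := Creutz–Miller -/

section Rows

variable (W : WeierstrassCurve ℚ) [W.IsElliptic] [W.IsGloballyMinimal]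
  -- PRINT⁷ shared by every row
  (h11 : thm11_ordTwo_LAlg_twist_eq_zero') (h12 : thm12_ordTwo_LAlg_twist_eq_one')
  (hMR' : MazurRubin2010.d2_eq_of_lemma210_rat) (hmod : exists_isNewformOf)
  (hAU : abbesUllmo_not_dvd_maninConstant_of_not_dvd_level)
  (hCM : bsdTriple_of_rank_le_one_of_conductor_lt) (hGZK : rank_eq_analyticRank_of_analyticRank_le_one)

/-- `ord_p(−(pᵏ·m)) = k` for a prime `p ∤ m` (valuation bookkeeping for the seeds' discriminants). [folklore] -/
theorem padicValRat_neg_pow_mul {p m : ℕ} [hp : Fact p.Prime] (k : ℕ) (hm : ¬ p ∣ m) :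
    padicValRat p (-((p : ℚ) ^ k * m)) = k := by
  have hm0 : m ≠ 0 := by rintro rfl; exact hm (dvd_zero p)
  rw [padicValRat.neg, show ((p : ℚ) ^ k * m) = ((p ^ k * m : ℕ) : ℚ) by push_cast; ring, padicValRat.of_nat,
    padicValNat.mul (pow_ne_zero _ hp.out.ne_zero) hm0, padicValNat.prime_pow, padicValNat.eq_zero_of_not_dvd hm]
  simp

/-- The bad primes of `1727a1` (`N = 11·157`) are multiplicative with `ord_p Δ = 1` (`Δ = −11·157`). [cite: CremonaAlgorithms1997, Table 1] -/
theorem bad_1727a1 : ∀ (p : ℕ) [Fact p.Prime], p ∣ c1727a1.conductorNorm ℤ →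
    c1727a1.HasMultiplicativeReductionAtPrime p ∧ Odd (padicValRat p c1727a1.Δ) := by
  intro p hp hpN
  rw [conductorNorm_1727a1, show (1727 : ℕ) = 11 * 157 by norm_num] at hpN
  have hΔ : c1727a1.Δ = ((-1727 : ℤ) : ℚ) := by
    rw [show c1727a1.Δ = ((M1727a1.Δ : ℤ) : ℚ) from baseChange_int_Δ M1727a1, M1727a1_Δ]
  rcases (Nat.Prime.dvd_mul hp.out).mp hpN with h | h
  · have hp' : p = 11 := (Nat.prime_dvd_prime_iff_eq hp.out (by norm_num)).mp h
    subst hp'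
    refine ⟨hasMultiplicativeReductionAtPrime_1727a1 11 (Or.inl rfl), ?_⟩
    rw [hΔ, show ((-1727 : ℤ) : ℚ) = -(((11 : ℕ) : ℚ) ^ 1 * (157 : ℕ)) by norm_num, padicValRat_neg_pow_mul 1 (by norm_num)]
    decide
  · have hp' : p = 157 := (Nat.prime_dvd_prime_iff_eq hp.out (by norm_num)).mp h
    subst hp'
    refine ⟨hasMultiplicativeReductionAtPrime_1727a1 157 (Or.inr rfl), ?_⟩
    rw [hΔ, show ((-1727 : ℤ) : ℚ) = -(((157 : ℕ) : ℚ) ^ 1 * (11 : ℕ)) by norm_num, padicValRat_neg_pow_mul 1 (by norm_num)]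
    decide

include h11 h12 hMR' hmod hAU hCM hGZK in
/-- **`BSD(W, 2)` PRINT-TRANSPORT on the whole `a_q`-odd twist class of `1727a1`**: for every square-free `d ≡ 1 (mod 4)`, `d ≠ 1`,
`(d, 1727) = 1` with `a_q(1727a1)` odd at every prime `q ∣ d`, and every globally minimal model `W` of `1727a1^{(d)}`:
`r_an(W) = 0 ∧ rank 0 ∧ Ш(W)[2^∞] = 0 ∧ c(W)` odd `∧ BSD(W, 2)`, modulo PRINT⁷ {Zhai 1.1′/1.2′, Mazur–Rubin L. 2.10, modularity, Abbes–Ullmo,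
Creutz–Miller 1.1, GZK} + displayed {`Dt` an `X₀(1727)`-optimality datum, `hL : ord₂(L(1727a1,1)/Ω_∞) = 0`}. No Kato, no certificate, no split
condition. CONDITIONAL; BSD is NOT proved. [cite: Zhai2016, Thm. 1.1] [cite: MazurRubin2010, Lemma 2.10] [cite: CreutzMiller2012, Thm. 1.1]
[cite: AbbesUllmo1996, Thm. A] [cite: Miller2011LMS, Def. 1.1] -/
theorem bsdp_two_twist_oddTrace_1727a1 [NeZero (c1727a1.conductorNorm ℤ)]
    (Dt : ModularParametrizationData c1727a1 (c1727a1.conductorNorm ℤ)) (hopt : Zhai2021.IsOptimalDatum c1727a1 Dt)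
    (hL : ∃ x : ℚ, IsLAlg c1727a1 x ∧ x ≠ 0 ∧ padicValRat 2 x = 0)
    {d : ℤ} (hsqf : Squarefree d) (hd1 : d ≠ 1) (hd4 : d % 4 = 1) (hgcd : Int.gcd d 1727 = 1)
    (hodd : ∀ q : ℕ, q.Prime → (q : ℤ) ∣ d → Odd (c1727a1.frobeniusTrace q))
    {c : VariableChange ℚ} (hc : c • c1727a1.quadraticTwist (d : ℚ) = W) :
    W.analyticRank = 0 ∧ W.mordellWeilRank = 0 ∧ AddCommGroup.primaryComponent W.sha 2 = ⊥ ∧ Odd W.tamagawaProduct ∧ BSDp W 2 := by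
  have hE : hasEntireLFunction_rat := WeierstrassCurve.hasEntireLFunction_rat_of_exists_isNewformOf hmod
  have hr : c1727a1.analyticRank = 0 := by
    obtain ⟨x, hx, hx0, -⟩ := hL
    exact analyticRank_eq_zero_of_isLAlg c1727a1 hE hx hx0
  exact bsdp_two_twist_oddTrace_of_print h11 h12 hMR' hmod hAU c1727a1 W Dt hopt (by rw [conductorNorm_1727a1]; norm_num) bad_1727a1
    irr_two_1727a1 Δ_1727a1_neg' (bsdp_two_1727a1_of_creutzMiller hCM hGZK hr) hL hsqf hd1 hd4 (by rwa [conductorNorm_1727a1]) hodd hc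

end Rows

/-! ## §4 (appended, same seat) The positive-discriminant twin of §2 -/

section GenericPos

/-- **`BSD(W, 2)` ON THE WHOLE `a_q`-ODD TWIST CLASS — PRINT-TRANSPORT, `0 < Δ(S)` twin of `bsdp_two_twist_oddTrace_of_print`.** Same seed
hypotheses except `0 < Δ(S)` and Zhai's unit datum in the form printed for positive discriminant, `ord₂(L(S,1)/Ω_∞(S)) = 1` (`c_∞ = 2`; Zhai 2016
Thm. 1.2′), and the class condition acquires `0 < d` (Zhai 1.2′ / Mazur–Rubin at `∞`). Conclusion identical: for every square-free `d ≡ 1 (mod 4)`, `d ≠ 1`,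
`0 < d`, `(d, N_S) = 1`, `a_q(S)` odd ∀ prime `q ∣ d`, and every globally minimal model `W` of `S^{(d)}`: `r_an(W) = 0 ∧ rank 0 ∧ Ш(W)[2^∞] = 0 ∧ c(W)`
odd `∧ BSD(W, 2)`, modulo PRINT⁵ + `BSD(S, 2)`. (No seed with `0 < Δ` is certified in the cell at the time of writing; recorded so that the (T) row is
sign-complete.) CONDITIONAL; BSD is NOT proved. [cite: Zhai2016, Thm. 1.2 (arXiv:1409.0231v2 Thm. 1.3)] [cite: MazurRubin2010, Lemma 2.10 (i)–(v), Prop. 3.3, Prop. 4.2]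
[cite: AbbesUllmo1996, Thm. A] [cite: Miller2011LMS, Def. 1.1] -/
theorem bsdp_two_twist_oddTrace_of_print_pos
    -- named published facts
    (h11 : thm11_ordTwo_LAlg_twist_eq_zero') (h12 : thm12_ordTwo_LAlg_twist_eq_one')
    (hMR' : MazurRubin2010.d2_eq_of_lemma210_rat) (hmod : exists_isNewformOf)
    (hAU : abbesUllmo_not_dvd_maninConstant_of_not_dvd_level)
    -- the seed
    (S W : WeierstrassCurve ℚ) [S.IsElliptic] [S.IsGloballyMinimal] [NeZero (S.conductorNorm ℤ)] [W.IsElliptic] [W.IsGloballyMinimal]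
    (Dt : ModularParametrizationData S (S.conductorNorm ℤ)) (hopt : Zhai2021.IsOptimalDatum S Dt)
    (hN2 : ¬ 2 ∣ S.conductorNorm ℤ)
    (hbad : ∀ (p : ℕ) [Fact p.Prime], p ∣ S.conductorNorm ℤ → S.HasMultiplicativeReductionAtPrime p ∧ Odd (padicValRat p S.Δ))
    (hirr : Irr S 2) (hΔ : 0 < S.Δ) (hbsd : BSDp S 2) (hL : ∃ x : ℚ, IsLAlg S x ∧ x ≠ 0 ∧ padicValRat 2 x = 1)
    -- the class condition on `d` (a_q-odd form), `0 < d`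
    {d : ℤ} (hsqf : Squarefree d) (hd1 : d ≠ 1) (hd4 : d % 4 = 1) (hd0 : 0 < d) (hgcd : Int.gcd d (S.conductorNorm ℤ) = 1)
    (hodd : ∀ q : ℕ, q.Prime → (q : ℤ) ∣ d → Odd (S.frobeniusTrace q))
    -- the member
    {c : VariableChange ℚ} (hc : c • S.quadraticTwist (d : ℚ) = W) :
    W.analyticRank = 0 ∧ W.mordellWeilRank = 0 ∧ AddCommGroup.primaryComponent W.sha 2 = ⊥ ∧ Odd W.tamagawaProduct ∧ BSDp W 2 := by
  haveI : Fact (Nat.Prime 2) := ⟨Nat.prime_two⟩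
  have hE : hasEntireLFunction_rat := WeierstrassCurve.hasEntireLFunction_rat_of_exists_isNewformOf hmod
  have hcinf : (S.baseChange ℝ).numRealComponents = 2 := P2.numRealComponents_eq_two_of_Δ_pos hΔ
  have hL' : ∃ x : ℚ, IsLAlg S x ∧ x ≠ 0 ∧ padicValRat 2 x = padicValNat 2 (S.baseChange ℝ).numRealComponents := by
    obtain ⟨x, hx, hx0, hv⟩ := hL
    exact ⟨x, hx, hx0, by rw [hcinf, hv]; simp⟩
  obtain ⟨hr, hsha, hcS⟩ := perBase_of_bsdp_of_isLAlg S hE hbsd hirr hL'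
  have hT := forall_two_nsmul_eq_zero_of_irr S hirr
  have hSha := forall_sha_two_of_primaryComponent_eq_bot S hsha
  have hS : ∀ (q : ℕ), q.Prime → (q : ℤ) ∣ d → ¬ (q : ℤ) ∣ minimalDiscriminantInt S ∧ Odd (S.frobeniusTrace q) := by
    intro q hq hqd
    haveI : Fact q.Prime := ⟨hq⟩
    refine ⟨?_, hodd q hq hqd⟩
    have hqN : ¬ q ∣ S.conductorNorm ℤ := by
      intro hqN
      have h1 : (q : ℤ) ∣ (Int.gcd d (S.conductorNorm ℤ) : ℤ) :=
        Int.dvd_coe_gcd hqd (by exact_mod_cast hqN)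
      rw [hgcd] at h1
      exact hq.one_lt.ne' (by exact_mod_cast Int.eq_one_of_dvd_one (by positivity) h1)
    have hgood : S.HasGoodReductionAtPrime q := by
      by_contra h
      exact hqN ((S.dvd_conductorNorm_iff_not_hasGoodReductionAtPrime q).mpr h)
    exact S.not_dvd_minimalDiscriminantInt_of_hasGoodReductionAtPrime q hgood
  have hadd : ∀ (p : ℕ) [Fact p.Prime], ¬ S.HasGoodReductionAtPrime p → ¬ S.HasMultiplicativeReductionAtPrime p → p ≠ 2 →
      jacobiSym d p = 1 := by
    intro p _ hng hnm _
    exact absurd (hbad p ((S.dvd_conductorNorm_iff_not_hasGoodReductionAtPrime p).mpr hng)).1 hnm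
  have hmev : ∀ (p : ℕ) [Fact p.Prime], S.HasMultiplicativeReductionAtPrime p → Even (padicValRat p S.Δ) → p ≠ 2 →
      jacobiSym d p = 1 := by
    intro p _ hm hev _
    have hng : ¬ S.HasGoodReductionAtPrime p := not_hasGoodReductionAtPrime_of_hasMultiplicativeReductionAtPrime p hm
    exact absurd hev (Int.not_even_iff_odd.mpr (hbad p ((S.dvd_conductorNorm_iff_not_hasGoodReductionAtPrime p).mpr hng)).2)
  have hM : ∃ C : VariableChange ℚ, C • W = S.quadraticTwist (d : ℚ) := P2.exists_smul_eq_comm.mpr ⟨c, hc⟩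
  exact U2.bsdp_two_twist_of_rankZero_base_oddConductor_placewise h11 h12 hMR' hmod hAU S W Dt hopt hN2 hr hbsd hSha hT hcS hsqf hd1
    hd4 hgcd hS hadd hmev (fun _ ↦ hd0) hM

end GenericPos

end Summit.BirchSwinnertonDyer.BirchSwinnertonDyer.Theorems.AlignedTransportAtTwoTwistFamilyZhaiTransport

end
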